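import Literature.MathematicalPhysics.KineticTheory.StaticHazardStatics
import Literature.MathematicalPhysics.KineticTheory.CellOccupancyLLN
import Literature.MathematicalPhysics.KineticTheory.CellOccupancyLargeDeviation
import Literature.MathematicalPhysics.KineticTheory.RelativeSpeedPairSums
import Literature.MathematicalPhysics.KineticTheory.EnskogRateConstMarkStatics
import HarnessLib

/-!
# `L¹` law of large numbers for the cell-scale collision-rate functional, rung 0

Topic `Literature/MathematicalPhysics/KineticTheory` (kind proof; companion of `StaticHazardStatics.lean`,
`CellOccupancyLLN.lean`, `RelativeSpeedPairSums.lean`, `EnskogRateConstMarkStatics.lean`).  Under the rung-0 local Gibbs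
law `G_N` (constant profiles `a, u, θ`) of `N + 1` hard spheres of diameter `σ(N+1)^{-1/3}` on `𝕋³`, the cell-scale
rate functional `cellRate(t, ·)` of `StaticHazardStatics` (Enskog's collision frequency read cell by cell on the
`r'`-coarse-grained state, Chapman–Cowling 1970 §16.4), at the ADMISSIBLE cell sizes `r' = 1/(2m)`, converges in
`L¹(G_N)` to the SAME deterministic value `(∫ χ(t,·)) g(σ³)Y(σ³) π E‖v − w‖` as the `r`-mollified Enskog rate functional
(`EnskogRateConstMarkLLN`), uniformly in `t ∈ [0, τ]`, once `m ≥ m₀` and then `N ≥ N₀(m)`: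

* `measurable_cellRate`, `posGibbsMeasure_exists_not_mem_admissibleCells`,
  `posGibbsMeasure_lt_abs_cellDensity_sub_one_le` — measurability, the seam is null, Chebyshev for a cell density;
* `abs_mul_sum_cellPairWeight_sub_le` — the deterministic estimate on the GOOD event (every sphere in an admissible
  cell, every admissible cell density within `Δ` of `1`): continuity of `g` and `Y` at `σ³`, the Riemann sums of the cone
  mollifier and of `χ(t,·)` over the cell centres;
* `lintegral_cellRate_sub_le` — the explicit `L¹` estimate at one `N`: velocity `U`-statistic by
  `lintegral_enorm_weightedRelSpeedSum_sub_le`; the good event by any deterministic bound `E_good`; the BAD event paid by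
  its probability;
* `exists_forall_lintegral_cellRate_sub_le` — the limit form (order of choices: `Δ`, `m₀`, `L`, `N₀`);
* window bookkeeping for the composition: `mainSum_eq` (the window sum of `h*·dil·ν̂` is `ε Σ_k cellRate(kw, p_k)`, so
  `(σ³w/ε) WS(h*·dil, ν̂) − RE = Σ_k σ³w (cellRate − e_{kw} ∘ Φ_{kw})`), `windowSum_eq_windowSum_mul_of_forall` (the clump
  term vanishes where every dilute cut is `1`), `exists_dense_of_toroidalDiluteCutCells_ne_one` (a cut `≠ 1` exhibits a
  dense occupied cell), `windowNum_le` (`Kw ≤ (τ/a + 1)(N+1)`).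

This is the cell side of the rung-0 mesoscale regularity of the crux line `Sketch` of
`InformationPercolationEngine.CollisionRate` (stmt-AtomisticToContinuum-13481, `stub_mesoscaleRegularityConst`).

## References

* S. Chapman, T. G. Cowling, *The Mathematical Theory of Non-Uniform Gases*, 3rd ed. (1970), §16.4.  [ChapmanCowling1970]
* H. Spohn, *Large Scale Dynamics of Interacting Particles* (1991), Part I §2.3.  [Spohn1991]
-/

noncomputable section

open MeasureTheory ProbabilityTheory Set Filter Topology
open scoped ENNReal BigOperators

namespace Literature.MathematicalPhysics.KineticTheory

open Literature.Analysis.FluidPDE Literature.MathematicalPhysics.StatisticalMechanics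

variable {σ : ℝ} {N : ℕ} {χ : ℝ × T3 → ℝ} {g : ℝ → ℝ} {r ηb t : ℝ}

/-! ## Measurability -/

/-- The static hazard of sphere `i` is a measurable function of the coarse state. [folklore] -/
theorem measurable_staticHazard (σ : ℝ) (N : ℕ) (r' : ℝ) (i : Fin (N + 1)) :
    Measurable fun p : CoarseState N => staticHazard σ N r' p i := by
  classical
  unfold staticHazard
  refine (measurable_const.mul (measurable_comp_cellsOf fun c => contactValue (σ ^ 3 * cellDensity N r' c (c i)))).mul
    (Measurable.div_const ?_ _)
  have hsum : (fun p : CoarseState N => ∑ j ∈ Finset.univ.filter (fun j : Fin (N + 1) => j ≠ i ∧ cellsOf p j = cellsOf p i),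
      ‖(p i).2 - (p j).2‖) = fun p => ∑ j, if j ≠ i ∧ cellsOf p j = cellsOf p i then ‖(p i).2 - (p j).2‖ else 0 := by
    funext p; rw [Finset.sum_filter]
  rw [hsum]
  refine Finset.measurable_sum _ fun j _ => Measurable.ite ?_ ?_ measurable_const
  · have h : {p : CoarseState N | j ≠ i ∧ cellsOf p j = cellsOf p i} =
        cellsOf ⁻¹' {c : Fin (N + 1) → (Fin 3 → ℤ) | j ≠ i ∧ c j = c i} := rfl
    rw [h]
    exact (measurable_cellsOf N) (Set.to_countable _).measurableSet
  · exact ((measurable_pi_apply i).snd.sub (measurable_pi_apply j).snd).norm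

/-- The cell-scale rate functional is a measurable function of the coarse state. [folklore] -/
theorem measurable_cellRate (σ : ℝ) (N : ℕ) (χ : ℝ × T3 → ℝ) (g : ℝ → ℝ) (r r' ηb t : ℝ) :
    Measurable (cellRate σ N χ g r r' ηb t) := by
  unfold cellRate toroidalDiluteCut
  refine measurable_const.mul (Finset.measurable_sum _ fun i _ => ?_)
  exact (measurable_comp_cellsOf fun c => χ (t, cellCentre r' (c i)) * g (σ ^ 3 * coarseMollDensity N r r' c i) *
    toroidalDiluteCutCells σ N r' ηb i c).mul (measurable_staticHazard σ N r' i)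

/-! ## The deterministic estimate on the good event -/

/-- **The total pair weight on the good event is close to the Enskog constant.**  Let every sphere lie in an admissible
cell and every admissible cell density be within `Δ ∈ [0, 1]` of `1`, with `σ³(1 + Δ) ≤ η̄ ≤ η₃`, `0 ≤ η̄`; let
`|χ(t,·)| ≤ C_χ`, `|g| ≤ K_g` on `[0, ∞)`, `|Y| ≤ K_Y` on `[0, η₃]`, `|Y(y) − Y(σ³)| ≤ ε_Y` for `|y − σ³| ≤ σ³Δ`,
`|g(y) − g(σ³)| ≤ ε_g` for `|y − σ³| ≤ σ³(2Δ + κ_m)` (`κ_m ≤ 1` the Riemann error of the cone mollifier) and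
`|χ(t,x) − χ(t,y)| ≤ ω` for `d(x,y) ≤ (√3/2) r'`.  Then, with `ι = 1/((N+1) r'³)`,
`|Θ̄ Σᵢⱼ wᵢⱼ − (∫χ(t,·)) g(σ³)Y(σ³) πΘ̄| ≤ Θ̄ π (C_χ (K_g K_Y (Δ + ι) + K_g ε_Y + ε_g K_Y) + K_g K_Y (C_χ Δ + ω))`.
[cite: ChapmanCowling1970, §16.4] -/
theorem abs_mul_sum_cellPairWeight_sub_le {m : ℕ} (hm : 1 ≤ m) (hσ : 0 ≤ σ) {r : ℝ} (hr : 0 < r) (hr2 : r < 1 / 2)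
    (hχ : Continuous χ) {Cχ Kg KY η₃ Δ εY εg ω Θb : ℝ} (hΘb : 0 ≤ Θb) (hCχ : ∀ x, |χ (t, x)| ≤ Cχ)
    (hKg : ∀ y, 0 ≤ y → |g y| ≤ Kg) (hKY : ∀ y, 0 ≤ y → y ≤ η₃ → |contactValue y| ≤ KY) (hηb0 : 0 ≤ ηb) (hηb : ηb ≤ η₃)
    (hΔ0 : 0 ≤ Δ) (hσΔ : σ ^ 3 * (1 + Δ) ≤ ηb)
    (hκ : 3 / (Real.pi * r ^ 4) * (Real.sqrt 3 / 2 * admissibleCellSize m) ≤ 1)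
    (hY : ∀ y, |y - σ ^ 3| ≤ σ ^ 3 * Δ → |contactValue y - contactValue (σ ^ 3)| ≤ εY)
    (hgc : ∀ y, |y - σ ^ 3| ≤ σ ^ 3 * (2 * Δ + 3 / (Real.pi * r ^ 4) * (Real.sqrt 3 / 2 * admissibleCellSize m)) →
      |g y - g (σ ^ 3)| ≤ εg)
    (hω : ∀ x y : T3, Torus.euclidDist x y ≤ Real.sqrt 3 / 2 * admissibleCellSize m → |χ (t, x) - χ (t, y)| ≤ ω)
    {c : Fin (N + 1) → (Fin 3 → ℤ)} (hc : ∀ j, c j ∈ admissibleCells m)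
    (hn : ∀ e ∈ admissibleCells m, |cellDensity N (admissibleCellSize m) c e - 1| ≤ Δ) :
    |Θb * ∑ i, ∑ j, cellPairWeight σ N χ g r (admissibleCellSize m) ηb t c i j -
        (∫ x, χ (t, x)) * (g (σ ^ 3) * contactValue (σ ^ 3)) * (Real.pi * Θb)| ≤
      Θb * (Real.pi * (Cχ * (Kg * KY * (Δ + ((((N + 1 : ℕ) : ℝ)) * admissibleCellSize m ^ 3)⁻¹) + Kg * εY + εg * KY) +
        Kg * KY * (Cχ * Δ + ω))) := by
  set r' := admissibleCellSize m with hr'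
  set ι : ℝ := ((((N + 1 : ℕ) : ℝ)) * r' ^ 3)⁻¹ with hι
  set g₀ := g (σ ^ 3) with hg₀
  set Y₀ := contactValue (σ ^ 3) with hY₀
  have hr'0 : 0 < r' := admissibleCellSize_pos hm
  have hι0 : 0 ≤ ι := by rw [hι]; positivity
  have hs0 : 0 ≤ σ ^ 3 := pow_nonneg hσ 3
  have hCχ0 : 0 ≤ Cχ := (abs_nonneg _).trans (hCχ 0)
  have hKg0 : 0 ≤ Kg := (abs_nonneg _).trans (hKg 0 le_rfl)
  have hKY0 : 0 ≤ KY := (abs_nonneg _).trans (hKY 0 le_rfl (hηb0.trans hηb))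
  have hεY0 : 0 ≤ εY := (abs_nonneg _).trans (hY (σ ^ 3) (by rw [sub_self, abs_zero]; positivity))
  have hεg0 : 0 ≤ εg := (abs_nonneg _).trans (hgc (σ ^ 3) (by
    rw [sub_self, abs_zero]; have := admissibleCellSize_pos hm; positivity))
  have hω0 : 0 ≤ ω := (abs_nonneg _).trans (hω 0 0 (by rw [show Torus.euclidDist (0 : T3) 0 = 0 by simp]; positivity))
  have hσ3η : σ ^ 3 ≤ η₃ := le_trans (by nlinarith) (hσΔ.trans hηb)
  have hg₀ : |g₀| ≤ Kg := hKg _ hs0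
  have hY₀ : |Y₀| ≤ KY := hKY _ hs0 hσ3η
  -- on the good event: the dilute cut is `1`, densities and mollified densities are near `1`
  have hnle : ∀ e ∈ admissibleCells m, cellDensity N r' c e ≤ 1 + Δ := fun e he => by
    have := (abs_le.1 (hn e he)).2; linarith
  have hdil : ∀ i, toroidalDiluteCutCells σ N r' ηb i c = 1 := toroidalDiluteCutCells_eq_one_of hσ hηb0 hσΔ hc hnle
  have hρ : ∀ i, |coarseMollDensity N r r' c i - 1| ≤ 2 * Δ + 3 / (Real.pi * r ^ 4) * (Real.sqrt 3 / 2 * r') := fun i =>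
    abs_coarseMollDensity_sub_one_le hm hr hr2 hΔ0 hκ hc hn i
  -- termwise estimate
  set E₁ : ℝ := Kg * KY * (Δ + ι) + Kg * εY + εg * KY with hE₁
  have hterm : ∀ i, |cellCoef σ N χ g r r' ηb t c i * (cellDensity N r' c (c i) - ι) -
      χ (t, cellCentre r' (c i)) * (Real.pi * (g₀ * Y₀))| ≤ Real.pi * Cχ * E₁ := by
    intro i
    set ni := cellDensity N r' c (c i) with hni
    set gi := g (σ ^ 3 * coarseMollDensity N r r' c i) with hgi
    set Yi := contactValue (σ ^ 3 * ni) with hYi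
    have hni1 : |ni - 1| ≤ Δ := hn (c i) (hc i)
    have hni0 : 0 ≤ σ ^ 3 * ni := mul_nonneg hs0 (cellDensity_nonneg N hr'0.le c (c i))
    have hniη : σ ^ 3 * ni ≤ η₃ :=
      ((mul_le_mul_of_nonneg_left (hnle (c i) (hc i)) hs0).trans hσΔ).trans hηb
    have hgib : |gi| ≤ Kg := hKg _ (mul_nonneg hs0 (coarseMollDensity_nonneg N hr r' c i))
    have hYib : |Yi| ≤ KY := hKY _ hni0 hniη
    have hYd : |Yi - Y₀| ≤ εY := hY _ (by
      rw [show σ ^ 3 * ni - σ ^ 3 = σ ^ 3 * (ni - 1) by ring, abs_mul, abs_of_nonneg hs0]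
      exact mul_le_mul_of_nonneg_left hni1 hs0)
    have hgd : |gi - g₀| ≤ εg := hgc _ (by
      rw [show σ ^ 3 * coarseMollDensity N r r' c i - σ ^ 3 = σ ^ 3 * (coarseMollDensity N r r' c i - 1) by ring, abs_mul,
        abs_of_nonneg hs0]
      exact mul_le_mul_of_nonneg_left (hρ i) hs0)
    have hcoef : cellCoef σ N χ g r r' ηb t c i = χ (t, cellCentre r' (c i)) * gi * (Real.pi * Yi) := by
      unfold cellCoef; rw [hdil i, mul_one]
    rw [hcoef, show χ (t, cellCentre r' (c i)) * gi * (Real.pi * Yi) * (ni - ι) - χ (t, cellCentre r' (c i)) * (Real.pi * (g₀ * Y₀)) =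
      Real.pi * χ (t, cellCentre r' (c i)) * (gi * Yi * (ni - 1 - ι) + gi * (Yi - Y₀) + (gi - g₀) * Y₀) by ring,
      abs_mul, abs_mul, abs_of_pos Real.pi_pos]
    refine mul_le_mul (mul_le_mul_of_nonneg_left (hCχ _) Real.pi_pos.le) ?_ (abs_nonneg _) (by positivity)
    calc |gi * Yi * (ni - 1 - ι) + gi * (Yi - Y₀) + (gi - g₀) * Y₀|
        ≤ |gi * Yi * (ni - 1 - ι)| + |gi * (Yi - Y₀)| + |(gi - g₀) * Y₀| := abs_add_three _ _ _
      _ ≤ Kg * KY * (Δ + ι) + Kg * εY + εg * KY := by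
          rw [abs_mul, abs_mul, abs_mul, abs_mul]
          refine add_le_add (add_le_add (mul_le_mul (mul_le_mul hgib hYib (abs_nonneg _) hKg0) ?_ (abs_nonneg _)
            (by positivity)) (mul_le_mul hgib hYd (abs_nonneg _) hKg0)) (mul_le_mul hgd hY₀ (abs_nonneg _) hεg0)
          calc |ni - 1 - ι| ≤ |ni - 1| + |ι| := abs_sub _ _
            _ ≤ Δ + ι := add_le_add hni1 (by rw [abs_of_nonneg hι0])
  -- sum over the spheres
  have hN : (0 : ℝ) < (((N + 1 : ℕ) : ℝ)) := by positivity
  have hsum1 : |∑ i, ∑ j, cellPairWeight σ N χ g r r' ηb t c i j -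
      (((N + 1 : ℕ) : ℝ))⁻¹ * ∑ i, χ (t, cellCentre r' (c i)) * (Real.pi * (g₀ * Y₀))| ≤ Real.pi * Cχ * E₁ := by
    rw [sum_cellPairWeight_eq hr'0.ne', ← mul_sub, ← Finset.sum_sub_distrib, abs_mul, abs_of_pos (inv_pos.2 hN)]
    calc (((N + 1 : ℕ) : ℝ))⁻¹ * |∑ i, (cellCoef σ N χ g r r' ηb t c i * (cellDensity N r' c (c i) - ι) -
          χ (t, cellCentre r' (c i)) * (Real.pi * (g₀ * Y₀)))|
        ≤ (((N + 1 : ℕ) : ℝ))⁻¹ * ∑ _i : Fin (N + 1), Real.pi * Cχ * E₁ :=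
          mul_le_mul_of_nonneg_left ((Finset.abs_sum_le_sum_abs _ _).trans (Finset.sum_le_sum fun i _ => hterm i))
            (inv_nonneg.2 hN.le)
      _ = Real.pi * Cχ * E₁ := by
          rw [Finset.sum_const, Finset.card_univ, Fintype.card_fin, nsmul_eq_mul]; field_simp
  -- the Riemann sums of `χ(t, ·)`
  have hreg : (((N + 1 : ℕ) : ℝ))⁻¹ * ∑ i, χ (t, cellCentre r' (c i)) * (Real.pi * (g₀ * Y₀)) =
      Real.pi * (g₀ * Y₀) * ∑ e ∈ admissibleCells m, r' ^ 3 * cellDensity N r' c e * χ (t, cellCentre r' e) := by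
    rw [← inv_mul_sum_eq_sum_cellDensity_mul hr'0.ne' hc (fun e => χ (t, cellCentre r' e)), Finset.mul_sum, Finset.mul_sum,
      Finset.mul_sum]
    exact Finset.sum_congr rfl fun i _ => by ring
  have hsum2 : |∑ e ∈ admissibleCells m, r' ^ 3 * cellDensity N r' c e * χ (t, cellCentre r' e) -
      ∑ e ∈ admissibleCells m, r' ^ 3 * χ (t, cellCentre r' e)| ≤ Cχ * Δ := by
    rw [← Finset.sum_sub_distrib]
    calc |∑ e ∈ admissibleCells m, (r' ^ 3 * cellDensity N r' c e * χ (t, cellCentre r' e) - r' ^ 3 * χ (t, cellCentre r' e))|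
        ≤ ∑ e ∈ admissibleCells m, |r' ^ 3 * cellDensity N r' c e * χ (t, cellCentre r' e) - r' ^ 3 * χ (t, cellCentre r' e)| :=
          Finset.abs_sum_le_sum_abs _ _
      _ ≤ ∑ e ∈ admissibleCells m, r' ^ 3 * (Cχ * Δ) := Finset.sum_le_sum fun e he => by
          rw [show r' ^ 3 * cellDensity N r' c e * χ (t, cellCentre r' e) - r' ^ 3 * χ (t, cellCentre r' e) =
            r' ^ 3 * (χ (t, cellCentre r' e) * (cellDensity N r' c e - 1)) by ring, abs_mul, abs_mul,
            abs_of_nonneg (pow_nonneg hr'0.le 3)]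
          exact mul_le_mul_of_nonneg_left (mul_le_mul (hCχ _) (hn e he) (abs_nonneg _) hCχ0) (pow_nonneg hr'0.le 3)
      _ = Cχ * Δ := by rw [← Finset.sum_mul, Finset.sum_const, nsmul_eq_mul, card_admissibleCells_mul_pow hm, one_mul]
  have hsum3 : |∑ e ∈ admissibleCells m, r' ^ 3 * χ (t, cellCentre r' e) - ∫ x, χ (t, x)| ≤ ω :=
    abs_sum_mul_sub_integral_le hm (integrable_of_continuous_T3 (hχ.comp (continuous_const.prodMk continuous_id))) hω
  -- assemble
  have hgY : |Real.pi * (g₀ * Y₀)| ≤ Real.pi * (Kg * KY) := by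
    rw [abs_mul, abs_of_pos Real.pi_pos, abs_mul]
    exact mul_le_mul_of_nonneg_left (mul_le_mul hg₀ hY₀ (abs_nonneg _) hKg0) Real.pi_pos.le
  have hkey : |∑ i, ∑ j, cellPairWeight σ N χ g r r' ηb t c i j - (∫ x, χ (t, x)) * (Real.pi * (g₀ * Y₀))| ≤
      Real.pi * (Cχ * E₁ + Kg * KY * (Cχ * Δ + ω)) := by
    have e1 : ∑ i, ∑ j, cellPairWeight σ N χ g r r' ηb t c i j - (∫ x, χ (t, x)) * (Real.pi * (g₀ * Y₀)) =
        (∑ i, ∑ j, cellPairWeight σ N χ g r r' ηb t c i j -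
          (((N + 1 : ℕ) : ℝ))⁻¹ * ∑ i, χ (t, cellCentre r' (c i)) * (Real.pi * (g₀ * Y₀))) +
        Real.pi * (g₀ * Y₀) * ((∑ e ∈ admissibleCells m, r' ^ 3 * cellDensity N r' c e * χ (t, cellCentre r' e) -
          ∑ e ∈ admissibleCells m, r' ^ 3 * χ (t, cellCentre r' e)) +
          (∑ e ∈ admissibleCells m, r' ^ 3 * χ (t, cellCentre r' e) - ∫ x, χ (t, x))) := by
      rw [hreg]; ring
    rw [e1]
    calc _ ≤ |∑ i, ∑ j, cellPairWeight σ N χ g r r' ηb t c i j -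
            (((N + 1 : ℕ) : ℝ))⁻¹ * ∑ i, χ (t, cellCentre r' (c i)) * (Real.pi * (g₀ * Y₀))| +
          |Real.pi * (g₀ * Y₀) * ((∑ e ∈ admissibleCells m, r' ^ 3 * cellDensity N r' c e * χ (t, cellCentre r' e) -
            ∑ e ∈ admissibleCells m, r' ^ 3 * χ (t, cellCentre r' e)) +
            (∑ e ∈ admissibleCells m, r' ^ 3 * χ (t, cellCentre r' e) - ∫ x, χ (t, x)))| := abs_add_le _ _
      _ ≤ Real.pi * Cχ * E₁ + Real.pi * (Kg * KY) * (Cχ * Δ + ω) := by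
          refine add_le_add hsum1 ?_
          rw [abs_mul]
          exact mul_le_mul hgY ((abs_add_le _ _).trans (add_le_add hsum2 hsum3)) (abs_nonneg _) (by positivity)
      _ = Real.pi * (Cχ * E₁ + Kg * KY * (Cχ * Δ + ω)) := by ring
  rw [show Θb * ∑ i, ∑ j, cellPairWeight σ N χ g r r' ηb t c i j - (∫ x, χ (t, x)) * (g₀ * Y₀) * (Real.pi * Θb) =
    Θb * (∑ i, ∑ j, cellPairWeight σ N χ g r r' ηb t c i j - (∫ x, χ (t, x)) * (Real.pi * (g₀ * Y₀))) by ring, abs_mul,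
    abs_of_nonneg hΘb]
  exact mul_le_mul_of_nonneg_left hkey hΘb

/-! ## The bad event has small probability -/

/-- **Almost surely every sphere lies in an admissible cell** under the configurational Gibbs measure (it has a density
with respect to the product Haar measure, for which the seam is null). [folklore] -/
theorem posGibbsMeasure_exists_not_mem_admissibleCells (a₀ : T3 → ℝ) (ε : ℝ) (N : ℕ) {m : ℕ} (hm : 1 ≤ m) :
    posGibbsMeasure a₀ ε (N + 1) {xs : Fin (N + 1) → T3 | ∃ j, Torus.coarseCell (admissibleCellSize m) (xs j) ∉ admissibleCells m} = 0 := by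
  have hac : posGibbsMeasure a₀ ε (N + 1) ≪ (volume : Measure (Fin (N + 1) → T3)) := withDensity_absolutelyContinuous _ _
  refine hac ?_
  have hT : volume {x : T3 | Torus.coarseCell (admissibleCellSize m) x ∉ admissibleCells m} = 0 := by
    have h := ae_coarseCell_mem_admissibleCells hm
    rw [ae_iff] at h
    exact h
  have hsub : {xs : Fin (N + 1) → T3 | ∃ j, Torus.coarseCell (admissibleCellSize m) (xs j) ∉ admissibleCells m} ⊆
      ⋃ j : Fin (N + 1), (Function.eval j) ⁻¹' {x : T3 | Torus.coarseCell (admissibleCellSize m) x ∉ admissibleCells m} := by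
    intro xs ⟨j, hj⟩; exact mem_iUnion.2 ⟨j, hj⟩
  refine measure_mono_null hsub ((measure_iUnion_null_iff).2 fun j => ?_)
  rw [volume_pi, (measurePreserving_eval (fun _ : Fin (N + 1) => (volume : Measure T3)) j).measure_preimage]
  · exact hT
  · exact ((Torus.measurable_coarseCell _) (admissibleCells m : Set (Fin 3 → ℤ)).to_countable.measurableSet.compl).nullMeasurableSet

/-- The cell density of a fixed cell is a measurable function of the positions. [folklore] -/
theorem measurable_cellDensity_coarseCell (N : ℕ) (r' : ℝ) (e : Fin 3 → ℤ) :
    Measurable fun xs : Fin (N + 1) → T3 => cellDensity N r' (fun j => Torus.coarseCell r' (xs j)) e := by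
  unfold cellDensity
  refine Measurable.div_const ?_ _
  have : (fun xs : Fin (N + 1) → T3 => ((Finset.univ.filter fun j : Fin (N + 1) => Torus.coarseCell r' (xs j) = e).card : ℝ)) =
      fun xs => ∑ j, if Torus.coarseCell r' (xs j) = e then (1 : ℝ) else 0 := by
    funext xs; rw [Finset.natCast_card_filter]
  rw [this]
  exact Finset.measurable_sum _ fun j _ =>
    (Measurable.ite (measurableSet_cellSet r' e) measurable_const measurable_const).comp (measurable_pi_apply j)

/-- **Chebyshev bound for a cell density**: `P_N(Δ < |n_e − 1|) ≤ ofReal(E[(n_e − 1)²]/Δ²)` (`0 < Δ`, `0 < r'`).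
[folklore] -/
theorem posGibbsMeasure_lt_abs_cellDensity_sub_one_le {a : ℝ} (ha : 0 < a) (hσ2 : σ ≤ 1 / 2) (N : ℕ) {r' : ℝ}
    (hr' : 0 < r') (e : Fin 3 → ℤ) {Δ : ℝ} (hΔ : 0 < Δ) :
    posGibbsMeasure (fun _ : T3 => a) (hsDiameter σ N) (N + 1)
        {xs | Δ < |cellDensity N r' (fun j => Torus.coarseCell r' (xs j)) e - 1|} ≤
      ENNReal.ofReal ((∫ xs, (cellDensity N r' (fun j => Torus.coarseCell r' (xs j)) e - 1) ^ 2
        ∂posGibbsMeasure (fun _ : T3 => a) (hsDiameter σ N) (N + 1)) / Δ ^ 2) := by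
  set P := posGibbsMeasure (fun _ : T3 => a) (hsDiameter σ N) (N + 1) with hP
  haveI : IsProbabilityMeasure P := by rw [hP]; exact isProbabilityMeasure_posGibbsMeasure continuous_const (fun _ => ha) hσ2 N
  set f : (Fin (N + 1) → T3) → ℝ := fun xs => (cellDensity N r' (fun j => Torus.coarseCell r' (xs j)) e - 1) ^ 2 with hf
  have hfm : Measurable f := ((measurable_cellDensity_coarseCell N r' e).sub measurable_const).pow_const 2
  have hfb : ∀ xs, |f xs| ≤ ((r' ^ 3)⁻¹ + 1) ^ 2 := by
    intro xs
    have hn0 : 0 ≤ cellDensity N r' (fun j => Torus.coarseCell r' (xs j)) e := cellDensity_nonneg N hr'.le _ e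
    have hn1 : cellDensity N r' (fun j => Torus.coarseCell r' (xs j)) e ≤ (r' ^ 3)⁻¹ := by
      unfold cellDensity
      rw [div_le_iff₀ (by positivity)]
      have hc : ((Finset.univ.filter fun j : Fin (N + 1) => Torus.coarseCell r' (xs j) = e).card : ℝ) ≤ (((N + 1 : ℕ) : ℝ)) := by
        exact_mod_cast (Finset.card_filter_le _ _).trans (by rw [Finset.card_univ, Fintype.card_fin])
      calc _ ≤ (((N + 1 : ℕ) : ℝ)) := hc
        _ = (r' ^ 3)⁻¹ * ((((N + 1 : ℕ) : ℝ)) * r' ^ 3) := by field_simp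
    rw [hf]; dsimp only
    rw [abs_of_nonneg (sq_nonneg _), ← sq_abs]
    refine pow_le_pow_left₀ (abs_nonneg _) ?_ 2
    rw [abs_le]; constructor <;> linarith [inv_nonneg.2 (pow_nonneg hr'.le 3)]
  have hfi : Integrable f P := Integrable.of_bound hfm.aestronglyMeasurable _ (ae_of_all _ fun xs => by
    rw [Real.norm_eq_abs]; exact hfb xs)
  have hsub : {xs : Fin (N + 1) → T3 | Δ < |cellDensity N r' (fun j => Torus.coarseCell r' (xs j)) e - 1|} ⊆
      {xs | ENNReal.ofReal (Δ ^ 2) ≤ ENNReal.ofReal (f xs)} := by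
    intro xs hxs
    refine ENNReal.ofReal_le_ofReal ?_
    rw [hf]; dsimp only
    rw [← sq_abs (cellDensity N r' (fun j => Torus.coarseCell r' (xs j)) e - 1)]
    exact pow_le_pow_left₀ hΔ.le hxs.le 2
  calc P {xs | Δ < |cellDensity N r' (fun j => Torus.coarseCell r' (xs j)) e - 1|}
      ≤ P {xs | ENNReal.ofReal (Δ ^ 2) ≤ ENNReal.ofReal (f xs)} := measure_mono hsub
    _ ≤ (∫⁻ xs, ENNReal.ofReal (f xs) ∂P) / ENNReal.ofReal (Δ ^ 2) :=
        meas_ge_le_lintegral_div hfm.ennreal_ofReal.aemeasurable (by simpa using hΔ.ne') ENNReal.ofReal_ne_top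
    _ = ENNReal.ofReal ((∫ xs, f xs ∂P) / Δ ^ 2) := by
        rw [← ofReal_integral_eq_lintegral_ofReal hfi (ae_of_all _ fun xs => sq_nonneg _),
          ENNReal.ofReal_div_of_pos (pow_pos hΔ 2)]

/-! ## The `L¹` estimate at one `N` -/

/-- **The `L¹` deviation of the cell-scale rate functional from a constant, at one `N`** (explicit form).  For any
deterministic bound `E_good` of `|Θ̄ Σᵢⱼ wᵢⱼ(c) − M|` valid on the GOOD cell configurations `c` (every sphere in an
admissible cell, every admissible cell density within `Δ` of `1`), with `|χ(t,·)| ≤ C_χ`, `|g| ≤ K_g` on `[0,∞)`,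
`|Y| ≤ K_Y` on `[0, η₃]`, `0 ≤ η̄ ≤ η₃`, `|M| ≤ C_M`, and any truncation level `L > 0`:
`∫⁻ ‖cellRate(t, coarse-graining of z) − M‖ₑ dG_N ≤ ofReal (√(32(N+1)³W²L²) + 2 S E‖v − w‖²/L + E_good)
  + ofReal (Θ̄ S + C_M) · Σ_{e admissible} P_N(Δ < |n_e − 1|)`,
`W = (N+1)⁻¹ C_χ K_g π K_Y/((N+1)r'³)`, `S = C_χ K_g π K_Y η̄/σ³`, `Θ̄ = E‖v − w‖`. [cite: ChapmanCowling1970, §16.4] -/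
theorem lintegral_cellRate_sub_le {a θ : ℝ} {u : V3} (hσ : 0 < σ) (hσ2 : σ ≤ 1 / 2) (ha : 0 < a) (hθ : 0 < θ) (N : ℕ)
    (Φ : HardSphereFlow (Torus.geometry (Fin 3)) (hsDiameter σ N) (N + 1)) {m : ℕ} (hm : 1 ≤ m)
    (hr : 0 < r) {Cχ Kg KY η₃ : ℝ} (hCχ : ∀ x, |χ (t, x)| ≤ Cχ) (hKg : ∀ y, 0 ≤ y → |g y| ≤ Kg)
    (hKY : ∀ y, 0 ≤ y → y ≤ η₃ → |contactValue y| ≤ KY) (hηb0 : 0 ≤ ηb) (hηb : ηb ≤ η₃)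
    {Δ Egood Mt CM : ℝ} (hEgood : 0 ≤ Egood) (hCM : |Mt| ≤ CM)
    (hgood : ∀ c : Fin (N + 1) → (Fin 3 → ℤ), (∀ j, c j ∈ admissibleCells m) →
      (∀ e ∈ admissibleCells m, |cellDensity N (admissibleCellSize m) c e - 1| ≤ Δ) →
      |(∫ p, ‖p.1 - p.2‖ ∂((gaussMeasure u θ).prod (gaussMeasure u θ))) *
        ∑ i, ∑ j, cellPairWeight σ N χ g r (admissibleCellSize m) ηb t c i j - Mt| ≤ Egood)
    {L : ℝ} (hL : 0 < L) :
    ∫⁻ z, ‖cellRate σ N χ g r (admissibleCellSize m) ηb t (coarseConfig (Torus.coarseCell (admissibleCellSize m)) z) - Mt‖ₑ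
        ∂(localGibbsLaw σ (fun _ => a) (fun _ => u) (fun _ => θ) N Φ) ≤
      ENNReal.ofReal (Real.sqrt (32 * (((N + 1 : ℕ) : ℝ)) ^ 3 *
          ((((N + 1 : ℕ) : ℝ))⁻¹ * (Cχ * Kg * (Real.pi * KY)) / ((((N + 1 : ℕ) : ℝ)) * admissibleCellSize m ^ 3)) ^ 2 * L ^ 2) +
        2 * (Cχ * Kg * (Real.pi * KY) * (ηb / σ ^ 3)) *
          ((∫ p, ‖p.1 - p.2‖ ^ 2 ∂((gaussMeasure u θ).prod (gaussMeasure u θ))) / L) + Egood) +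
      ENNReal.ofReal ((∫ p, ‖p.1 - p.2‖ ∂((gaussMeasure u θ).prod (gaussMeasure u θ))) *
          (Cχ * Kg * (Real.pi * KY) * (ηb / σ ^ 3)) + CM) *
        ∑ e ∈ admissibleCells m, posGibbsMeasure (fun _ : T3 => a) (hsDiameter σ N) (N + 1)
          {xs | Δ < |cellDensity N (admissibleCellSize m) (fun j => Torus.coarseCell (admissibleCellSize m) (xs j)) e - 1|} := by
  -- notation
  set r' := admissibleCellSize m with hr'
  set γ : Measure V3 := gaussMeasure u θ with hγ
  set Γ : Measure (Fin (N + 1) → V3) := Measure.pi fun _ : Fin (N + 1) => γ with hΓ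
  set P : Measure (Fin (N + 1) → T3) := posGibbsMeasure (fun _ : T3 => a) (hsDiameter σ N) (N + 1) with hP
  set Θb : ℝ := ∫ p, ‖p.1 - p.2‖ ∂(γ.prod γ) with hΘb
  set C₂ : ℝ := ∫ p, ‖p.1 - p.2‖ ^ 2 ∂(γ.prod γ) with hC₂
  set n : ℝ := ((N + 1 : ℕ) : ℝ) with hn
  set Wt : ℝ := n⁻¹ * (Cχ * Kg * (Real.pi * KY)) / (n * r' ^ 3) with hWt
  set St : ℝ := Cχ * Kg * (Real.pi * KY) * (ηb / σ ^ 3) with hSt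
  set PSB : ℝ := Real.sqrt (32 * n ^ 3 * Wt ^ 2 * L ^ 2) + 2 * St * (C₂ / L) with hPSB
  set cc : (Fin (N + 1) → T3) → Fin (N + 1) → (Fin 3 → ℤ) := fun xs j => Torus.coarseCell r' (xs j) with hcc
  set w := fun xs : Fin (N + 1) → T3 => cellPairWeight σ N χ g r r' ηb t (cc xs) with hw
  set Bad₁ : Set (Fin (N + 1) → T3) := {xs | ∃ j, Torus.coarseCell r' (xs j) ∉ admissibleCells m} with hBad₁
  set BadE : (Fin 3 → ℤ) → Set (Fin (N + 1) → T3) := fun e => {xs | Δ < |cellDensity N r' (cc xs) e - 1|} with hBadE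
  set Bad : Set (Fin (N + 1) → T3) := Bad₁ ∪ ⋃ e ∈ admissibleCells m, BadE e with hBad
  haveI hPprob : IsProbabilityMeasure P := by
    rw [hP]; exact isProbabilityMeasure_posGibbsMeasure continuous_const (fun _ => ha) hσ2 N
  have hr'0 : 0 < r' := admissibleCellSize_pos hm
  have hΘb0 : 0 ≤ Θb := integral_norm_sub_prod_gaussMeasure_nonneg u θ
  have hC₂0 : 0 ≤ C₂ := integral_nonneg fun _ => sq_nonneg _
  have hCM0 : 0 ≤ CM := (abs_nonneg _).trans hCM
  have hSt0 : 0 ≤ St := le_trans (Finset.sum_nonneg fun i _ => Finset.sum_nonneg fun j _ => abs_nonneg _)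
    (sum_abs_cellPairWeight_le (N := N) (t := t) hσ hr hr'0 hCχ hKg hKY hηb0 hηb fun _ => 0)
  have hPSB0 : 0 ≤ PSB := by rw [hPSB]; positivity
  -- the weights
  have hwW : ∀ xs i j, |w xs i j| ≤ Wt := fun xs i j => abs_cellPairWeight_le hσ.le hr hr'0 hCχ hKg hKY hηb0 hηb _ i j
  have hwS : ∀ xs, ∑ i, ∑ j, |w xs i j| ≤ St := fun xs => sum_abs_cellPairWeight_le hσ hr hr'0 hCχ hKg hKY hηb0 hηb _
  have hwdiag : ∀ xs i, w xs i i = 0 := fun xs i => cellPairWeight_diag σ N χ g r r' ηb t _ i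
  -- measurability
  have hBad₁m : MeasurableSet Bad₁ := by
    have : Bad₁ = ⋃ j : Fin (N + 1), (Function.eval j) ⁻¹' {x : T3 | Torus.coarseCell r' x ∉ admissibleCells m} := by
      ext xs; simp [hBad₁]
    rw [this]
    exact MeasurableSet.iUnion fun j => (measurable_pi_apply j)
      ((Torus.measurable_coarseCell _) (admissibleCells m : Set (Fin 3 → ℤ)).to_countable.measurableSet.compl)
  have hBadEm : ∀ e, MeasurableSet (BadE e) := fun e =>
    measurableSet_lt measurable_const ((measurable_cellDensity_coarseCell N r' e).sub measurable_const).abs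
  have hBadm : MeasurableSet Bad := hBad₁m.union (MeasurableSet.biUnion (admissibleCells m).countable_toSet fun e _ => hBadEm e)
  have hFm : Measurable fun z : Config (N + 1) (Fin 3) T3 =>
      ‖cellRate σ N χ g r r' ηb t (coarseConfig (Torus.coarseCell r') z) - Mt‖ₑ :=
    (((measurable_cellRate σ N χ g r r' ηb t).comp (measurable_coarseConfig (Torus.measurable_coarseCell r'))).sub
      measurable_const).enorm
  -- STEP 1: rung-0 disintegration
  rw [lintegral_localGibbsLaw_rung0 σ ha.le hθ u N Φ (F := fun z =>
    ‖cellRate σ N χ g r r' ηb t (coarseConfig (Torus.coarseCell r') z) - Mt‖ₑ) hFm]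
  -- STEP 2: pointwise in `(xs, vs)`
  have hpt : ∀ (xs : Fin (N + 1) → T3) (vs : Fin (N + 1) → V3),
      ‖cellRate σ N χ g r r' ηb t (coarseConfig (Torus.coarseCell r') (zipConfig (xs, vs))) - Mt‖ₑ ≤
        ‖∑ i, ∑ j, w xs i j * (‖vs i - vs j‖ - Θb)‖ₑ + ‖Θb * ∑ i, ∑ j, w xs i j - Mt‖ₑ := by
    intro xs vs
    have hdec : cellRate σ N χ g r r' ηb t (coarseConfig (Torus.coarseCell r') (zipConfig (xs, vs))) - Mt =
        (∑ i, ∑ j, w xs i j * (‖vs i - vs j‖ - Θb)) + (Θb * ∑ i, ∑ j, w xs i j - Mt) := by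
      rw [cellRate_coarseConfig_zipConfig_eq, hw, hcc]
      simp only [mul_sub, Finset.sum_sub_distrib, ← Finset.sum_mul]
      ring
    rw [hdec]
    exact enorm_add_le _ _
  -- STEP 3: velocities
  have hvel : ∀ xs : Fin (N + 1) → T3,
      ∫⁻ vs, ‖cellRate σ N χ g r r' ηb t (coarseConfig (Torus.coarseCell r') (zipConfig (xs, vs))) - Mt‖ₑ ∂Γ ≤
        ENNReal.ofReal PSB + ‖Θb * ∑ i, ∑ j, w xs i j - Mt‖ₑ := by
    intro xs
    have hps := lintegral_enorm_weightedRelSpeedSum_sub_le (n := N + 1) u θ (hwW xs) (hwS xs) (hwdiag xs) hL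
    calc _ ≤ ∫⁻ vs, (‖∑ i, ∑ j, w xs i j * (‖vs i - vs j‖ - Θb)‖ₑ + ‖Θb * ∑ i, ∑ j, w xs i j - Mt‖ₑ) ∂Γ :=
          lintegral_mono fun vs => hpt xs vs
      _ = (∫⁻ vs, ‖∑ i, ∑ j, w xs i j * (‖vs i - vs j‖ - Θb)‖ₑ ∂Γ) + ‖Θb * ∑ i, ∑ j, w xs i j - Mt‖ₑ := by
          rw [lintegral_add_right _ measurable_const, lintegral_const, measure_univ, mul_one]
      _ ≤ ENNReal.ofReal PSB + ‖Θb * ∑ i, ∑ j, w xs i j - Mt‖ₑ := add_le_add hps le_rfl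
  -- STEP 4: positions, pointwise
  have hpos : ∀ xs : Fin (N + 1) → T3, ‖Θb * ∑ i, ∑ j, w xs i j - Mt‖ₑ ≤
      ENNReal.ofReal Egood + ENNReal.ofReal (Θb * St + CM) * Bad.indicator 1 xs := by
    intro xs
    by_cases hxs : xs ∈ Bad
    · rw [Set.indicator_of_mem hxs, Pi.one_apply, mul_one, Real.enorm_eq_ofReal_abs]
      refine le_add_left (ENNReal.ofReal_le_ofReal ?_)
      calc |Θb * ∑ i, ∑ j, w xs i j - Mt| ≤ |Θb * ∑ i, ∑ j, w xs i j| + |Mt| := abs_sub _ _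
        _ ≤ Θb * St + CM := add_le_add ?_ hCM
      rw [abs_mul, abs_of_nonneg hΘb0]
      exact mul_le_mul_of_nonneg_left ((Finset.abs_sum_le_sum_abs _ _).trans
        ((Finset.sum_le_sum fun i _ => Finset.abs_sum_le_sum_abs _ _).trans (hwS xs))) hΘb0
    · rw [Set.indicator_of_notMem hxs, mul_zero, add_zero, Real.enorm_eq_ofReal_abs]
      refine ENNReal.ofReal_le_ofReal (hgood (cc xs) (fun j => ?_) (fun e he => ?_))
      · by_contra hj
        exact hxs (Or.inl ⟨j, hj⟩)
      · by_contra hlt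
        push Not at hlt
        exact hxs (Or.inr (mem_iUnion₂.2 ⟨e, he, hlt⟩))
  -- STEP 5: positions, integrated
  have hPBad : P Bad ≤ ∑ e ∈ admissibleCells m, P (BadE e) := by
    calc P Bad ≤ P Bad₁ + P (⋃ e ∈ admissibleCells m, BadE e) := measure_union_le _ _
      _ ≤ 0 + ∑ e ∈ admissibleCells m, P (BadE e) := add_le_add (le_of_eq (by
          rw [hP]; exact posGibbsMeasure_exists_not_mem_admissibleCells _ _ N hm)) (measure_biUnion_finset_le _ _)
      _ = _ := zero_add _
  calc ∫⁻ xs, ∫⁻ vs, ‖cellRate σ N χ g r r' ηb t (coarseConfig (Torus.coarseCell r') (zipConfig (xs, vs))) - Mt‖ₑ ∂Γ ∂P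
      ≤ ∫⁻ xs, (ENNReal.ofReal PSB + ENNReal.ofReal Egood + ENNReal.ofReal (Θb * St + CM) * Bad.indicator 1 xs) ∂P := by
        refine lintegral_mono fun xs => (hvel xs).trans ?_
        rw [add_assoc]
        exact add_le_add le_rfl (hpos xs)
    _ = ENNReal.ofReal PSB + ENNReal.ofReal Egood + ENNReal.ofReal (Θb * St + CM) * P Bad := by
        rw [lintegral_add_left measurable_const, lintegral_const, measure_univ, mul_one,
          lintegral_const_mul' _ _ ENNReal.ofReal_ne_top, lintegral_indicator_one hBadm]
    _ ≤ ENNReal.ofReal (PSB + Egood) + ENNReal.ofReal (Θb * St + CM) * ∑ e ∈ admissibleCells m, P (BadE e) := by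
        rw [ENNReal.ofReal_add hPSB0 hEgood]
        exact add_le_add le_rfl (mul_le_mul_right hPBad _)

/-! ## Window bookkeeping for the composition (cutoff bound, window sums, dense event, number of windows) -/

/-- A continuous cutoff vanishing on `[η₀', ∞)` is bounded on `[0, ∞)`. [folklore] -/
theorem exists_bound_cutoff {g : ℝ → ℝ} {η₀' : ℝ} (hg : Continuous g) (hg0 : ∀ x, η₀' ≤ x → g x = 0) :
    ∃ Kg : ℝ, ∀ y, 0 ≤ y → |g y| ≤ Kg := by
  obtain ⟨Cg, hCg⟩ := (isCompact_Icc (a := (0 : ℝ)) (b := max η₀' 0)).exists_bound_of_continuousOn hg.continuousOn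
  refine ⟨max Cg 0, fun y hy => ?_⟩
  by_cases hy' : η₀' ≤ y
  · rw [hg0 y hy', abs_zero]; exact le_max_right _ _
  · have h := hCg y ⟨hy, (le_of_lt (not_le.1 hy')).trans (le_max_left _ _)⟩
    rw [Real.norm_eq_abs] at h
    exact h.trans (le_max_left _ _)

/-! ## The window sums of the statistic -/

section WindowSums

variable (Φ : HardSphereFlow (Torus.geometry (Fin 3)) (hsDiameter σ N) (N + 1))

/-- The hazard weight at a window `k < Kw`, unfolded. [folklore] -/
theorem hazardWeight_eq_of_lt (χ : ℝ × T3 → ℝ) (g : ℝ → ℝ) (r r' τ a : ℝ) (i : Fin (N + 1)) {k : ℕ}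
    (hk : k < windowNum N τ a) (p : CoarseState N) :
    hazardWeight σ N χ g r r' τ a i k p =
      χ ((k : ℝ) * windowLen N τ a, cellCentre r' (cellsOf p i)) * g (σ ^ 3 * coarseMollDensity N r r' (cellsOf p) i) := by
  unfold hazardWeight hazardWeightCells
  rw [if_pos hk]

/-- **The clump term vanishes when every dilute cut is `1`**: `WS(h, D) = WS(h·dil, D)` at a point all of whose window
starts have `dilᵢ = 1`. [folklore] -/
theorem windowSum_eq_windowSum_mul_of_forall (r' τ a ηb : ℝ) (h : Fin (N + 1) → ℕ → CoarseState N → ℝ)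
    (X : Fin (N + 1) → ℕ → Config (N + 1) (Fin 3) T3 → ℝ) {z : Config (N + 1) (Fin 3) T3}
    (hz : ∀ k ∈ Finset.range (windowNum N τ a), ∀ i, toroidalDiluteCut σ N r' ηb i (coarseStateAt σ N Φ r' τ a k z) = 1) :
    windowSum σ N Φ r' τ a h X z =
      windowSum σ N Φ r' τ a (fun i k p => h i k p * toroidalDiluteCut σ N r' ηb i p) X z := by
  unfold windowSum
  congr 1
  refine Finset.sum_congr rfl fun i _ => Finset.sum_congr rfl fun k hk => ?_
  dsimp only
  rw [hz k hk i, mul_one]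

/-- **The main term is a sum over the windows**: `(σ³w/ε) WS(h*·dil, ν̂) − RE = Σ_{k<Kw} σ³ w (cellRate(kw, p_k) − e_{kw} ∘ Φ_{kw})`
(`ε ≠ 0`). [folklore] -/
theorem mainSum_eq (χ : ℝ × T3 → ℝ) (g : ℝ → ℝ) (r r' τ a ηb : ℝ) (hε : hsDiameter σ N ≠ 0) (z : Config (N + 1) (Fin 3) T3) :
    σ ^ 3 * windowLen N τ a / hsDiameter σ N *
        windowSum σ N Φ r' τ a (fun i k p => hazardWeight σ N χ g r r' τ a i k p * toroidalDiluteCut σ N r' ηb i p)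
          (fun i k z => staticHazard σ N r' (coarseStateAt σ N Φ r' τ a k z) i) z -
      riemannEnskog σ N Φ τ a χ g r z =
      ∑ k ∈ Finset.range (windowNum N τ a), σ ^ 3 * windowLen N τ a *
        (cellRate σ N χ g r r' ηb ((k : ℝ) * windowLen N τ a) (coarseStateAt σ N Φ r' τ a k z) -
          enskogRate σ N χ g (fun _ => 1) r ((k : ℝ) * windowLen N τ a) (Φ.flow ((k : ℝ) * windowLen N τ a) z)) := by
  have hN : (((N : ℝ) + 1)) ≠ 0 := by positivity
  -- the window sum of `h*·dil·ν̂` is `ε Σ_k cellRate(kw, p_k)`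
  have h1 : windowSum σ N Φ r' τ a (fun i k p => hazardWeight σ N χ g r r' τ a i k p * toroidalDiluteCut σ N r' ηb i p)
      (fun i k z => staticHazard σ N r' (coarseStateAt σ N Φ r' τ a k z) i) z =
      hsDiameter σ N * ∑ k ∈ Finset.range (windowNum N τ a),
        cellRate σ N χ g r r' ηb ((k : ℝ) * windowLen N τ a) (coarseStateAt σ N Φ r' τ a k z) := by
    unfold windowSum cellRate
    rw [Finset.sum_comm]
    simp only [Finset.mul_sum]
    refine Finset.sum_congr rfl fun k hk => Finset.sum_congr rfl fun i _ => ?_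
    rw [hazardWeight_eq_of_lt χ g r r' τ a i (Finset.mem_range.1 hk)]
    push_cast
    field_simp
  rw [h1]
  unfold riemannEnskog
  rw [Finset.mul_sum, Finset.mul_sum, Finset.mul_sum, ← Finset.sum_sub_distrib]
  refine Finset.sum_congr rfl fun k _ => ?_
  field_simp

end WindowSums

/-! ## The dense event -/

/-- **A dilute cut that is not `1` exhibits a dense occupied cell**: if `dilᵢ(c) ≠ 1` then some sphere `j` has
`(η̄/σ³)(N+1) r'³ < #{l : c_l = c_j}` (`0 < σ`, `0 < r'`, `0 ≤ η̄`: empty cells pass the cut). [folklore] -/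
theorem exists_dense_of_toroidalDiluteCutCells_ne_one {σ : ℝ} {N : ℕ} {r' ηb : ℝ} (hσ : 0 < σ) (hr' : 0 < r') (hηb0 : 0 ≤ ηb)
    {i : Fin (N + 1)} {c : Fin (N + 1) → (Fin 3 → ℤ)} (h : toroidalDiluteCutCells σ N r' ηb i c ≠ 1) :
    ∃ j : Fin (N + 1), ηb / σ ^ 3 * (((N + 1 : ℕ) : ℝ)) * r' ^ 3 <
      ((Finset.univ.filter fun l : Fin (N + 1) => c l = c j).card : ℝ) := by
  by_cases hall : ∀ e : Fin 3 → ℤ, Torus.euclidDist (cellCentre r' e) (cellCentre r' (c i)) < 2 * r' →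
      σ ^ 3 * cellDensity N r' c e ≤ ηb
  · exfalso; apply h; unfold toroidalDiluteCutCells; rw [if_pos hall]
  push Not at hall
  obtain ⟨e, -, he⟩ := hall
  have hs : 0 < σ ^ 3 := pow_pos hσ 3
  have hpos : 0 < ((Finset.univ.filter fun l : Fin (N + 1) => c l = e).card : ℝ) := by
    by_contra hle
    push Not at hle
    have h0 : ((Finset.univ.filter fun l : Fin (N + 1) => c l = e).card : ℝ) = 0 := le_antisymm hle (Nat.cast_nonneg _)
    have : cellDensity N r' c e = 0 := by unfold cellDensity; rw [h0, zero_div]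
    rw [this, mul_zero] at he
    linarith
  obtain ⟨j, hj⟩ : ∃ j, j ∈ Finset.univ.filter fun l : Fin (N + 1) => c l = e :=
    Finset.card_pos.1 (by exact_mod_cast hpos)
  have hje : c j = e := (Finset.mem_filter.1 hj).2
  refine ⟨j, ?_⟩
  rw [hje]
  unfold cellDensity at he
  rw [mul_div_assoc', lt_div_iff₀ (by positivity)] at he
  calc ηb / σ ^ 3 * (((N + 1 : ℕ) : ℝ)) * r' ^ 3 = ηb * ((((N + 1 : ℕ) : ℝ)) * r' ^ 3) / σ ^ 3 := by ring
    _ < σ ^ 3 * ((Finset.univ.filter fun l : Fin (N + 1) => c l = e).card : ℝ) / σ ^ 3 :=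
        div_lt_div_of_pos_right he hs
    _ = _ := by field_simp

/-- The dense-occupancy event of the positions is measurable. [folklore] -/
theorem measurableSet_denseEvent (N : ℕ) (r' κ : ℝ) :
    MeasurableSet {xs : Fin (N + 1) → T3 | ∃ j : Fin (N + 1), κ * (((N + 1 : ℕ) : ℝ)) * r' ^ 3 <
      ((Finset.univ.filter fun l : Fin (N + 1) => Torus.coarseCell r' (xs l) = Torus.coarseCell r' (xs j)).card : ℝ)} := by
  have hset : {xs : Fin (N + 1) → T3 | ∃ j : Fin (N + 1), κ * (((N + 1 : ℕ) : ℝ)) * r' ^ 3 <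
      ((Finset.univ.filter fun l : Fin (N + 1) => Torus.coarseCell r' (xs l) = Torus.coarseCell r' (xs j)).card : ℝ)} =
      ⋃ j : Fin (N + 1), {xs | κ * (((N + 1 : ℕ) : ℝ)) * r' ^ 3 <
        ((Finset.univ.filter fun l : Fin (N + 1) => Torus.coarseCell r' (xs l) = Torus.coarseCell r' (xs j)).card : ℝ)} := by
    ext xs; simp
  rw [hset]
  refine MeasurableSet.iUnion fun j => measurableSet_lt measurable_const ?_
  have : (fun xs : Fin (N + 1) → T3 => ((Finset.univ.filter fun l : Fin (N + 1) =>
      Torus.coarseCell r' (xs l) = Torus.coarseCell r' (xs j)).card : ℝ)) =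
      fun xs => ∑ l, if Torus.coarseCell r' (xs l) = Torus.coarseCell r' (xs j) then (1 : ℝ) else 0 := by
    funext xs; rw [Finset.natCast_card_filter]
  rw [this]
  exact Finset.measurable_sum _ fun l _ => Measurable.ite (measurableSet_sameCell r' l j) measurable_const measurable_const

/-- **The number of windows is at most `(τ/a + 1)(N+1)`** (`0 < τ`, `0 < a`). [folklore] -/
theorem windowNum_le (N : ℕ) {τ a : ℝ} (hτ : 0 < τ) (ha : 0 < a) :
    (windowNum N τ a : ℝ) ≤ (τ / a + 1) * (((N + 1 : ℕ) : ℝ)) := by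
  have hn1 : (1 : ℝ) ≤ (((N + 1 : ℕ) : ℝ)) := by exact_mod_cast Nat.succ_le_succ (Nat.zero_le N)
  have hpow : (((N + 1 : ℕ) : ℝ)) ^ (-(1 / 3 : ℝ)) = ((((N + 1 : ℕ) : ℝ)) ^ ((1 / 3 : ℝ)))⁻¹ :=
    Real.rpow_neg (by positivity) _
  have h13 : (((N + 1 : ℕ) : ℝ)) ^ ((1 / 3 : ℝ)) ≤ (((N + 1 : ℕ) : ℝ)) := by
    have h := Real.rpow_le_rpow_of_exponent_le hn1 (show (1 / 3 : ℝ) ≤ 1 by norm_num)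
    rwa [Real.rpow_one] at h
  have hceil := (Nat.ceil_lt_add_one (show 0 ≤ τ / (a * (((N + 1 : ℕ) : ℝ)) ^ (-(1 / 3 : ℝ))) by positivity)).le
  unfold windowNum
  refine hceil.trans ?_
  rw [hpow, show τ / (a * ((((N + 1 : ℕ) : ℝ)) ^ ((1 / 3 : ℝ)))⁻¹) = τ / a * (((N + 1 : ℕ) : ℝ)) ^ ((1 / 3 : ℝ)) by
    field_simp]
  have hτa : 0 ≤ τ / a := by positivity
  nlinarith [mul_le_mul_of_nonneg_left h13 hτa]

/-! ## The limit form -/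

set_option maxHeartbeats 800000 in
/-- **`L¹` law of large numbers for the cell-scale rate functional, rung 0** (the limit form).  At small reduced
density, for constant profiles `a, θ > 0`, `u`, continuous `χ, g` with `|g| ≤ K_g` on `[0, ∞)`, `|Y| ≤ K_Y` on `[0, η₃]`,
`Y` continuous at `σ³`, `0 ≤ η̄ ≤ η₃` with `2σ³ ≤ η̄`, `0 < r < 1/2`, any horizon `τ` and `ε > 0`: there is `m₀` such
that for every admissible cell size `r' = 1/(2m)`, `m ≥ m₀`, there is `N₀` with
`∫⁻ ‖cellRate(t, coarse state of z) − (∫χ(t,·)) g(σ³)Y(σ³) π E‖v − w‖‖ₑ dG_N ≤ ofReal ε` for `N ≥ N₀`, every flow and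
every `t ∈ [0, τ]`.  Order of choices: the density tolerance `Δ` (continuity of `g` and `Y` at `σ³`), `m₀` (Riemann
errors of the cone mollifier and of `χ`), the truncation level `L`, then `N₀` (velocity `U`-statistic, `1/((N+1)r'³)`,
mean-square cell-density deviations). [cite: ChapmanCowling1970, §16.4] -/
theorem exists_forall_lintegral_cellRate_sub_le {a θ : ℝ} (hsd : SmallDensity uniformProfile σ) (ha : 0 < a)
    (hθ : 0 < θ) (u : V3) (hχ : Continuous χ) (hg : Continuous g) {Kg KY η₃ : ℝ} (hKg : ∀ y, 0 ≤ y → |g y| ≤ Kg)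
    (hKY : ∀ y, 0 ≤ y → y ≤ η₃ → |contactValue y| ≤ KY) (hYc : ContinuousAt contactValue (σ ^ 3))
    (hηb0 : 0 ≤ ηb) (hηb : ηb ≤ η₃) (hσb : 2 * σ ^ 3 ≤ ηb) (hr : 0 < r) (hr2 : r < 1 / 2) (τ : ℝ) {ε : ℝ} (hε : 0 < ε) :
    ∃ m₀ : ℕ, ∀ m : ℕ, m₀ ≤ m → 1 ≤ m → ∃ N₀ : ℕ, ∀ N : ℕ, N₀ ≤ N →
      ∀ Φ : HardSphereFlow (Torus.geometry (Fin 3)) (hsDiameter σ N) (N + 1), ∀ t ∈ Set.Icc (0 : ℝ) τ,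
        ∫⁻ z, ‖cellRate σ N χ g r (admissibleCellSize m) ηb t (coarseConfig (Torus.coarseCell (admissibleCellSize m)) z) -
            (∫ x, χ (t, x)) * (g (σ ^ 3) * contactValue (σ ^ 3)) *
              (Real.pi * ∫ p, ‖p.1 - p.2‖ ∂((gaussMeasure u θ).prod (gaussMeasure u θ)))‖ₑ
          ∂(localGibbsLaw σ (fun _ => a) (fun _ => u) (fun _ => θ) N Φ) ≤ ENNReal.ofReal ε := by
  have hσ : 0 < σ := hsd.σ_pos
  have hσ2 : σ ≤ 1 / 2 := hsd.σ_lt_half.le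
  have hs : 0 < σ ^ 3 := pow_pos hσ 3
  -- `χ` is bounded and uniformly continuous on `[0, τ] × 𝕋³`
  have hKc : IsCompact (Set.Icc (0 : ℝ) τ ×ˢ (univ : Set T3)) := isCompact_Icc.prod isCompact_univ
  obtain ⟨Cχ, hCχ⟩ := hKc.exists_bound_of_continuousOn hχ.continuousOn
  obtain ⟨A, hA⟩ : ∃ A : ℝ, A = max Cχ 0 + 1 := ⟨_, rfl⟩
  have hA0 : 0 < A := by rw [hA]; positivity
  have hχA : ∀ t ∈ Set.Icc (0 : ℝ) τ, ∀ x, |χ (t, x)| ≤ A := fun t ht x => by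
    have h := hCχ (t, x) ⟨ht, mem_univ _⟩
    rw [Real.norm_eq_abs] at h
    exact h.trans ((le_max_left _ _).trans (by rw [hA]; linarith))
  have hUC := hKc.uniformContinuousOn_of_continuous hχ.continuousOn
  -- constants
  set Θb : ℝ := ∫ p, ‖p.1 - p.2‖ ∂((gaussMeasure u θ).prod (gaussMeasure u θ)) with hΘb
  set C₂ : ℝ := ∫ p, ‖p.1 - p.2‖ ^ 2 ∂((gaussMeasure u θ).prod (gaussMeasure u θ)) with hC₂
  have hΘb0 : 0 ≤ Θb := integral_norm_sub_prod_gaussMeasure_nonneg u θ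
  have hC₂0 : 0 ≤ C₂ := integral_nonneg fun _ => sq_nonneg _
  have hKg0 : 0 ≤ Kg := (abs_nonneg _).trans (hKg 0 le_rfl)
  have hKY0 : 0 ≤ KY := (abs_nonneg _).trans (hKY 0 le_rfl (hηb0.trans hηb))
  obtain ⟨Q, hQ⟩ : ∃ Q : ℝ, Q = Θb * Real.pi + 1 := ⟨_, rfl⟩
  have hQ0 : 0 < Q := by rw [hQ]; positivity
  have hΘπQ : Θb * Real.pi ≤ Q := by rw [hQ]; linarith
  obtain ⟨e6, he6⟩ : ∃ e6 : ℝ, e6 = ε / (24 * Q) := ⟨_, rfl⟩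
  have he60 : 0 < e6 := by rw [he6]; positivity
  have hQe6 : Q * (6 * e6) = ε / 4 := by rw [he6]; field_simp; ring
  -- elementary inequalities (small context)
  have t3 : A * (Kg * (e6 / (A * Kg + 1))) ≤ e6 := by
    rw [show A * (Kg * (e6 / (A * Kg + 1))) = (A * Kg) * e6 / (A * Kg + 1) by ring,
      div_le_iff₀ (by positivity : 0 < A * Kg + 1)]
    nlinarith
  have t4 : A * (e6 / (A * KY + 1) * KY) ≤ e6 := by
    rw [show A * (e6 / (A * KY + 1) * KY) = (A * KY) * e6 / (A * KY + 1) by ring,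
      div_le_iff₀ (by positivity : 0 < A * KY + 1)]
    nlinarith
  have t6 : Kg * KY * (e6 / (Kg * KY + 1)) ≤ e6 := by
    rw [show Kg * KY * (e6 / (Kg * KY + 1)) = (Kg * KY) * e6 / (Kg * KY + 1) by ring,
      div_le_iff₀ (by positivity : 0 < Kg * KY + 1)]
    nlinarith
  -- continuity scales of `Y` and `g` at `σ³`
  obtain ⟨δY, hδY0, hδY⟩ := Metric.continuousAt_iff.1 hYc (e6 / (A * Kg + 1)) (by positivity)
  obtain ⟨δg, hδg0, hδg⟩ := Metric.continuousAt_iff.1 hg.continuousAt (e6 / (A * KY + 1)) (by positivity)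
  -- the density tolerance `Δ`
  obtain ⟨Δ, hΔ⟩ : ∃ Δ : ℝ, Δ = min 1 (min (δY / (2 * σ ^ 3)) (min (δg / (8 * σ ^ 3)) (e6 / (A * Kg * KY + 1)))) := ⟨_, rfl⟩
  have hΔ0 : 0 < Δ := by rw [hΔ]; positivity
  have hΔ1 : Δ ≤ 1 := by rw [hΔ]; exact min_le_left _ _
  have hΔY : Δ ≤ δY / (2 * σ ^ 3) := by rw [hΔ]; exact (min_le_right _ _).trans (min_le_left _ _)
  have hΔg : Δ ≤ δg / (8 * σ ^ 3) := by rw [hΔ]; exact ((min_le_right _ _).trans (min_le_right _ _)).trans (min_le_left _ _)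
  have hΔe : Δ ≤ e6 / (A * Kg * KY + 1) := by rw [hΔ]; exact ((min_le_right _ _).trans (min_le_right _ _)).trans (min_le_right _ _)
  have hσΔ : σ ^ 3 * (1 + Δ) ≤ ηb := by nlinarith
  have t1 : A * (Kg * KY) * Δ ≤ e6 := by
    have h : A * (Kg * KY) * Δ ≤ A * (Kg * KY) * (e6 / (A * Kg * KY + 1)) := mul_le_mul_of_nonneg_left hΔe (by positivity)
    refine h.trans ?_
    rw [show A * (Kg * KY) * (e6 / (A * Kg * KY + 1)) = (A * Kg * KY) * e6 / (A * Kg * KY + 1) by ring,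
      div_le_iff₀ (by positivity : 0 < A * Kg * KY + 1)]
    nlinarith
  have hgood6 : Θb * (Real.pi * (A * (Kg * KY * (Δ + 0) + Kg * (e6 / (A * Kg + 1)) + e6 / (A * KY + 1) * KY) +
      Kg * KY * (A * Δ + e6 / (Kg * KY + 1)))) ≤ ε / 4 := by
    have hinner : A * (Kg * KY * (Δ + 0) + Kg * (e6 / (A * Kg + 1)) + e6 / (A * KY + 1) * KY) +
        Kg * KY * (A * Δ + e6 / (Kg * KY + 1)) ≤ 6 * e6 := by
      have e : A * (Kg * KY * (Δ + 0) + Kg * (e6 / (A * Kg + 1)) + e6 / (A * KY + 1) * KY) +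
          Kg * KY * (A * Δ + e6 / (Kg * KY + 1)) = A * (Kg * KY) * Δ + A * (Kg * (e6 / (A * Kg + 1))) +
          A * (e6 / (A * KY + 1) * KY) + A * (Kg * KY) * Δ + Kg * KY * (e6 / (Kg * KY + 1)) := by ring
      rw [e]; linarith
    calc _ = (Θb * Real.pi) * (A * (Kg * KY * (Δ + 0) + Kg * (e6 / (A * Kg + 1)) + e6 / (A * KY + 1) * KY) +
        Kg * KY * (A * Δ + e6 / (Kg * KY + 1))) := by ring
      _ ≤ Q * (6 * e6) := mul_le_mul hΘπQ hinner (by positivity) hQ0.le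
      _ = ε / 4 := hQe6
  -- the Riemann scales: `ω` for `χ`, `κ` for the cone mollifier
  obtain ⟨ρ, hρ0, hρ⟩ := Metric.uniformContinuousOn_iff.1 hUC (e6 / (Kg * KY + 1)) (by positivity)
  obtain ⟨κt, hκt⟩ : ∃ κt : ℝ, κt = min 1 (δg / (4 * σ ^ 3)) := ⟨_, rfl⟩
  have hκt0 : 0 < κt := by rw [hκt]; positivity
  obtain ⟨ρ₂, hρ₂⟩ : ∃ ρ₂ : ℝ, ρ₂ = κt / (3 / (Real.pi * r ^ 4) * (Real.sqrt 3 / 2) + 1) := ⟨_, rfl⟩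
  have hρ₂0 : 0 < ρ₂ := by rw [hρ₂]; positivity
  refine ⟨max (⌈1 / (2 * ρ)⌉₊ + 1) (⌈1 / (2 * ρ₂)⌉₊ + 1), fun m hm hm1 => ?_⟩
  set r' := admissibleCellSize m with hr'
  have hr'0 : 0 < r' := admissibleCellSize_pos hm1
  have hr'ρ : r' < ρ := admissibleCellSize_lt hρ0 (by
    have h1 := Nat.le_ceil (1 / (2 * ρ))
    have h2 : (⌈1 / (2 * ρ)⌉₊ : ℝ) + 1 ≤ m := by exact_mod_cast (le_max_left _ _).trans hm
    linarith)
  have hr'ρ₂ : r' < ρ₂ := admissibleCellSize_lt hρ₂0 (by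
    have h1 := Nat.le_ceil (1 / (2 * ρ₂))
    have h2 : (⌈1 / (2 * ρ₂)⌉₊ : ℝ) + 1 ≤ m := by exact_mod_cast (le_max_right _ _).trans hm
    linarith)
  have hκ : 3 / (Real.pi * r ^ 4) * (Real.sqrt 3 / 2 * r') ≤ κt := by
    have hc0 : (0 : ℝ) ≤ 3 / (Real.pi * r ^ 4) * (Real.sqrt 3 / 2) := by positivity
    calc 3 / (Real.pi * r ^ 4) * (Real.sqrt 3 / 2 * r') = (3 / (Real.pi * r ^ 4) * (Real.sqrt 3 / 2)) * r' := by ring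
      _ ≤ (3 / (Real.pi * r ^ 4) * (Real.sqrt 3 / 2) + 1) * ρ₂ :=
          mul_le_mul (by linarith) hr'ρ₂.le hr'0.le (by positivity)
      _ = κt := by rw [hρ₂]; field_simp
  have hκ1 : 3 / (Real.pi * r ^ 4) * (Real.sqrt 3 / 2 * r') ≤ 1 := hκ.trans (by rw [hκt]; exact min_le_left _ _)
  have hκg : 3 / (Real.pi * r ^ 4) * (Real.sqrt 3 / 2 * r') ≤ δg / (4 * σ ^ 3) := hκ.trans (by rw [hκt]; exact min_le_right _ _)
  -- the hypotheses of the deterministic estimate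
  have hY : ∀ y, |y - σ ^ 3| ≤ σ ^ 3 * Δ → |contactValue y - contactValue (σ ^ 3)| ≤ e6 / (A * Kg + 1) := by
    intro y hy
    have h1 : σ ^ 3 * Δ < δY := by
      calc σ ^ 3 * Δ ≤ σ ^ 3 * (δY / (2 * σ ^ 3)) := mul_le_mul_of_nonneg_left hΔY hs.le
        _ = δY / 2 := by field_simp
        _ < δY := by linarith
    have h := hδY (by rw [Real.dist_eq]; exact hy.trans_lt h1)
    rw [Real.dist_eq] at h
    exact h.le
  have hgc : ∀ y, |y - σ ^ 3| ≤ σ ^ 3 * (2 * Δ + 3 / (Real.pi * r ^ 4) * (Real.sqrt 3 / 2 * r')) →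
      |g y - g (σ ^ 3)| ≤ e6 / (A * KY + 1) := by
    intro y hy
    have h1 : σ ^ 3 * (2 * Δ + 3 / (Real.pi * r ^ 4) * (Real.sqrt 3 / 2 * r')) < δg := by
      calc σ ^ 3 * (2 * Δ + 3 / (Real.pi * r ^ 4) * (Real.sqrt 3 / 2 * r'))
          ≤ σ ^ 3 * (2 * (δg / (8 * σ ^ 3)) + δg / (4 * σ ^ 3)) := by gcongr
        _ = δg / 2 := by field_simp; ring
        _ < δg := by linarith
    have h := hδg (by rw [Real.dist_eq]; exact hy.trans_lt h1)
    rw [Real.dist_eq] at h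
    exact h.le
  have h32 : Real.sqrt 3 / 2 ≤ 1 := by
    rw [div_le_one (by norm_num : (0 : ℝ) < 2)]
    have : Real.sqrt 3 < 2 := by
      rw [show (2 : ℝ) = Real.sqrt 4 by rw [show (4 : ℝ) = 2 ^ 2 by norm_num, Real.sqrt_sq (by norm_num)]]
      exact Real.sqrt_lt_sqrt (by norm_num) (by norm_num)
    linarith
  have hω : ∀ t ∈ Set.Icc (0 : ℝ) τ, ∀ x y : T3, Torus.euclidDist x y ≤ Real.sqrt 3 / 2 * r' →
      |χ (t, x) - χ (t, y)| ≤ e6 / (Kg * KY + 1) := by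
    intro t ht x y hxy
    have hd : dist ((t, x) : ℝ × T3) (t, y) < ρ := by
      rw [Prod.dist_eq, dist_self, max_eq_right dist_nonneg, dist_eq_norm]
      calc ‖x - y‖ ≤ Torus.euclidDist x y := Torus.norm_sub_le_euclidDist_holds x y
        _ ≤ Real.sqrt 3 / 2 * r' := hxy
        _ ≤ 1 * r' := mul_le_mul_of_nonneg_right h32 hr'0.le
        _ < ρ := by rw [one_mul]; exact hr'ρ
    have h := hρ (t, x) ⟨ht, mem_univ _⟩ (t, y) ⟨ht, mem_univ _⟩ hd
    rw [Real.dist_eq] at h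
    exact h.le
  -- the truncation level `L`
  obtain ⟨St, hSt⟩ : ∃ St : ℝ, St = A * Kg * (Real.pi * KY) * (ηb / σ ^ 3) := ⟨_, rfl⟩
  have hSt0 : 0 ≤ St := by rw [hSt]; positivity
  obtain ⟨L, hL⟩ : ∃ L : ℝ, L = 16 * St * C₂ / ε + 1 := ⟨_, rfl⟩
  have hL0 : 0 < L := by rw [hL]; positivity
  have hLterm : 2 * St * (C₂ / L) ≤ ε / 8 := by
    have h1 : 16 * St * C₂ ≤ ε * L := by
      have e : ε * L = 16 * St * C₂ + ε := by rw [hL]; field_simp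
      rw [e]; linarith
    rw [show 2 * St * (C₂ / L) = (2 * St * C₂) / L by ring, div_le_iff₀ hL0]
    nlinarith
  -- the `N`-dependent terms tend to zero
  have hinv : Tendsto (fun N : ℕ => (((N + 1 : ℕ) : ℝ))⁻¹) atTop (𝓝 0) :=
    tendsto_inv_atTop_zero.comp ((tendsto_natCast_atTop_atTop (R := ℝ)).comp (tendsto_add_atTop_nat 1))
  have hsqrt : Tendsto (fun N : ℕ => Real.sqrt (32 * (((N + 1 : ℕ) : ℝ)) ^ 3 *
      ((((N + 1 : ℕ) : ℝ))⁻¹ * (A * Kg * (Real.pi * KY)) / ((((N + 1 : ℕ) : ℝ)) * r' ^ 3)) ^ 2 * L ^ 2)) atTop (𝓝 0) := by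
    have h1 : Tendsto (fun N : ℕ => 32 * (A * Kg * (Real.pi * KY)) ^ 2 * L ^ 2 / r' ^ 6 * (((N + 1 : ℕ) : ℝ))⁻¹)
        atTop (𝓝 0) := by
      have h := hinv.const_mul (32 * (A * Kg * (Real.pi * KY)) ^ 2 * L ^ 2 / r' ^ 6)
      rw [mul_zero] at h
      exact h
    have h2 := h1.sqrt
    rw [Real.sqrt_zero] at h2
    refine h2.congr fun N => ?_
    congr 1
    have hN : (((N + 1 : ℕ) : ℝ)) ≠ 0 := by positivity
    have hr6 : r' ^ 6 = (r' ^ 3) ^ 2 := by ring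
    rw [hr6]
    field_simp
  have hι : Tendsto (fun N : ℕ => ((((N + 1 : ℕ) : ℝ)) * r' ^ 3)⁻¹) atTop (𝓝 0) := by
    have h := hinv.mul_const (r' ^ 3)⁻¹
    rw [zero_mul] at h
    refine h.congr fun N => ?_
    rw [mul_inv]
  have hvar : Tendsto (fun N : ℕ => ∑ e ∈ admissibleCells m, (∫ xs, (cellDensity N r' (fun j => Torus.coarseCell r' (xs j)) e - 1) ^ 2
      ∂posGibbsMeasure (fun _ : T3 => a) (hsDiameter σ N) (N + 1)) / Δ ^ 2) atTop (𝓝 0) := by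
    have h := tendsto_finsetSum (admissibleCells m) (fun e he =>
      (tendsto_integral_sq_cellDensity_sub_one hsd ha hm1 he).div_const (Δ ^ 2))
    simpa using h
  -- the total bound as a function of `N` and its limit
  obtain ⟨Cbad, hCbad⟩ : ∃ Cbad : ℝ, Cbad = Θb * St + A * (Kg * KY) * (Real.pi * Θb) := ⟨_, rfl⟩
  have hCbad0 : 0 ≤ Cbad := by rw [hCbad]; positivity
  obtain ⟨f, hf⟩ : ∃ f : ℕ → ℝ, f = fun N => Real.sqrt (32 * (((N + 1 : ℕ) : ℝ)) ^ 3 *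
      ((((N + 1 : ℕ) : ℝ))⁻¹ * (A * Kg * (Real.pi * KY)) / ((((N + 1 : ℕ) : ℝ)) * r' ^ 3)) ^ 2 * L ^ 2) +
    2 * St * (C₂ / L) +
    Θb * (Real.pi * (A * (Kg * KY * (Δ + ((((N + 1 : ℕ) : ℝ)) * r' ^ 3)⁻¹) + Kg * (e6 / (A * Kg + 1)) +
      e6 / (A * KY + 1) * KY) + Kg * KY * (A * Δ + e6 / (Kg * KY + 1)))) +
    Cbad * (∑ e ∈ admissibleCells m, (∫ xs, (cellDensity N r' (fun j => Torus.coarseCell r' (xs j)) e - 1) ^ 2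
      ∂posGibbsMeasure (fun _ : T3 => a) (hsDiameter σ N) (N + 1)) / Δ ^ 2) := ⟨_, rfl⟩
  obtain ⟨ℓ, hℓ⟩ : ∃ ℓ : ℝ, ℓ = 0 + 2 * St * (C₂ / L) +
    Θb * (Real.pi * (A * (Kg * KY * (Δ + 0) + Kg * (e6 / (A * Kg + 1)) + e6 / (A * KY + 1) * KY) +
      Kg * KY * (A * Δ + e6 / (Kg * KY + 1)))) + Cbad * 0 := ⟨_, rfl⟩
  have hflim : Tendsto f atTop (𝓝 ℓ) := by
    rw [hf, hℓ]
    refine Tendsto.add (Tendsto.add (hsqrt.add tendsto_const_nhds) (Tendsto.const_mul Θb (Tendsto.const_mul Real.pi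
      (Tendsto.add (Tendsto.const_mul A ?_) tendsto_const_nhds)))) (hvar.const_mul Cbad)
    exact Tendsto.add (Tendsto.add (Tendsto.const_mul _ (tendsto_const_nhds.add hι)) tendsto_const_nhds) tendsto_const_nhds
  have hℓε : ℓ < ε := by rw [hℓ]; linarith
  obtain ⟨N₀, hN₀⟩ := eventually_atTop.1 (hflim.eventually (gt_mem_nhds hℓε))
  refine ⟨N₀, fun N hN Φ t ht => ?_⟩
  -- apply the one-`N` estimate
  have hMt : |(∫ x, χ (t, x)) * (g (σ ^ 3) * contactValue (σ ^ 3)) * (Real.pi * Θb)| ≤ A * (Kg * KY) * (Real.pi * Θb) := by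
    have hI : |∫ x, χ (t, x)| ≤ A := by
      have h := norm_integral_le_of_norm_le_const (μ := (volume : Measure T3)) (f := fun x => χ (t, x)) (C := A)
        (ae_of_all _ fun x => by rw [Real.norm_eq_abs]; exact hχA t ht x)
      rwa [probReal_univ, mul_one, Real.norm_eq_abs] at h
    have hgY : |g (σ ^ 3) * contactValue (σ ^ 3)| ≤ Kg * KY := by
      rw [abs_mul]
      exact mul_le_mul (hKg _ hs.le) (hKY _ hs.le (by nlinarith)) (abs_nonneg _) hKg0
    rw [abs_mul, abs_mul, abs_of_nonneg (by positivity : 0 ≤ Real.pi * Θb)]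
    exact mul_le_mul_of_nonneg_right (mul_le_mul hI hgY (abs_nonneg _) hA0.le) (by positivity)
  have hgoodc : ∀ c : Fin (N + 1) → (Fin 3 → ℤ), (∀ j, c j ∈ admissibleCells m) →
      (∀ e ∈ admissibleCells m, |cellDensity N r' c e - 1| ≤ Δ) →
      |Θb * ∑ i, ∑ j, cellPairWeight σ N χ g r r' ηb t c i j -
        (∫ x, χ (t, x)) * (g (σ ^ 3) * contactValue (σ ^ 3)) * (Real.pi * Θb)| ≤
      Θb * (Real.pi * (A * (Kg * KY * (Δ + ((((N + 1 : ℕ) : ℝ)) * r' ^ 3)⁻¹) + Kg * (e6 / (A * Kg + 1)) +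
        e6 / (A * KY + 1) * KY) + Kg * KY * (A * Δ + e6 / (Kg * KY + 1)))) := fun c hc hn =>
    abs_mul_sum_cellPairWeight_sub_le hm1 hσ.le hr hr2 hχ hΘb0 (hχA t ht) hKg hKY hηb0 hηb hΔ0.le hσΔ hκ1 hY hgc (hω t ht) hc hn
  have hmain := lintegral_cellRate_sub_le (u := u) hσ hσ2 ha hθ N Φ hm1 hr (hχA t ht) hKg hKY hηb0 hηb
    (by positivity) hMt hgoodc hL0
  refine hmain.trans ?_
  -- the bad probabilities by Chebyshev
  have hcheb : ∑ e ∈ admissibleCells m, posGibbsMeasure (fun _ : T3 => a) (hsDiameter σ N) (N + 1)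
      {xs | Δ < |cellDensity N r' (fun j => Torus.coarseCell r' (xs j)) e - 1|} ≤
      ENNReal.ofReal (∑ e ∈ admissibleCells m, (∫ xs, (cellDensity N r' (fun j => Torus.coarseCell r' (xs j)) e - 1) ^ 2
        ∂posGibbsMeasure (fun _ : T3 => a) (hsDiameter σ N) (N + 1)) / Δ ^ 2) := by
    rw [ENNReal.ofReal_sum_of_nonneg (fun e _ => div_nonneg (integral_nonneg fun xs => sq_nonneg _) (sq_nonneg _))]
    exact Finset.sum_le_sum fun e _ => posGibbsMeasure_lt_abs_cellDensity_sub_one_le ha hσ2 N hr'0 e hΔ0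
  have hfN : f N < ε := hN₀ N hN
  calc _ ≤ ENNReal.ofReal (Real.sqrt (32 * (((N + 1 : ℕ) : ℝ)) ^ 3 *
          ((((N + 1 : ℕ) : ℝ))⁻¹ * (A * Kg * (Real.pi * KY)) / ((((N + 1 : ℕ) : ℝ)) * r' ^ 3)) ^ 2 * L ^ 2) +
          2 * (A * Kg * (Real.pi * KY) * (ηb / σ ^ 3)) * (C₂ / L) +
          Θb * (Real.pi * (A * (Kg * KY * (Δ + ((((N + 1 : ℕ) : ℝ)) * r' ^ 3)⁻¹) + Kg * (e6 / (A * Kg + 1)) +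
            e6 / (A * KY + 1) * KY) + Kg * KY * (A * Δ + e6 / (Kg * KY + 1))))) +
        ENNReal.ofReal (Θb * (A * Kg * (Real.pi * KY) * (ηb / σ ^ 3)) + A * (Kg * KY) * (Real.pi * Θb)) *
          ENNReal.ofReal (∑ e ∈ admissibleCells m,
            (∫ xs, (cellDensity N r' (fun j => Torus.coarseCell r' (xs j)) e - 1) ^ 2
              ∂posGibbsMeasure (fun _ : T3 => a) (hsDiameter σ N) (N + 1)) / Δ ^ 2) :=
        add_le_add le_rfl (mul_le_mul_right hcheb _)
    _ = ENNReal.ofReal (f N) := by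
        rw [hf, ← hSt, ← hCbad, ← ENNReal.ofReal_mul hCbad0, ← ENNReal.ofReal_add (by positivity) (by positivity)]
    _ ≤ ENNReal.ofReal ε := ENNReal.ofReal_le_ofReal hfN.le

end Literature.MathematicalPhysics.KineticTheory

end
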